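import Mathlib.RingTheory.Ideal.MinimalPrime.Noetherian
import Mathlib.AlgebraicGeometry.Noetherian
import Literature.AlgebraicGeometry.Motives.SubschemeCyclesProofs
import Literature.AlgebraicGeometry.Motives.SubschemeCyclesCodimProofs
import Literature.RingTheory.KrullDimension.BaseChangeDimension
import HarnessLib

/-!
# Local finiteness of the support of flat pull-backs: proofs (trunk MotiveL, prelude C1)

Discharges the named fact `Literature.AlgebraicGeometry.Motives.locallyFinsupp_flatPullbackFun_baseChangeHomFst` of
`Literature.AlgebraicGeometry.Motives.SubschemeCycles`: for a `k`-scheme `X` locally of finite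
type, a homomorphism of fields `σ : k →+* L` and the projection `π : X_σ = X ×_{k,σ} Spec L ⟶ X`,
the coefficient function `(π^* c)(z) = c(π z) · ℓ(𝒪_{(X_σ)_{π z}, z})` of the pull-back of any cycle
`c` on `X` has locally finite support, so that `π^* c = c_L` is again a cycle
(Fulton, *Intersection Theory*, Example 6.2.9: "For a `k`-cycle `α = ∑ n_V [V]` on `X`, let `α_L`
be the `k`-cycle `∑ n_V [V_L]` on `X_L`"; §1.7: "`f^*[V] = [f⁻¹(V)]` … `[f⁻¹(V)]` is its cycle
(§1.5)"; §1.5: "let `X₁, …, X_t` be the irreducible components of `X`" — a scheme algebraic over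
a field has finitely many).

We prove, more generally, that **for every morphism `f : X ⟶ Y` with `X` locally Noetherian and
every cycle `c` on `Y`, `f.flatPullbackFun c` has locally finite support**
(`Literature.AlgebraicGeometry.Motives.locallyFiniteSupport_flatPullbackFun_of_isLocallyNoetherian`); the fact follows because
`X_σ` is locally of finite type over `L`, hence locally Noetherian.

## Proof

Let `z ∈ X`. Choose affine opens `f z ∈ U ⊆ Y` and `z ∈ U' ⊆ f⁻¹ U`, `U' = Spec R'` with `R'`
Noetherian. The quasi-compact `U` meets `supp c` in a finite set `{y₁, …, yₙ}`. If
`(f^* c)(z') ≠ 0` for some `z' ∈ U'`, then `f z' = yᵢ` for some `i` and the local ring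
`𝒪_{X_{yᵢ}, z'} ≅ R'_𝔮 ⧸ 𝔭ᵢ R'_𝔮` of the fibre has finite length (`𝔮`, `𝔭ᵢ` the primes of `z'`,
`yᵢ`; `Literature.AlgebraicGeometry.Motives.nonempty_stalkFiber_ringEquiv_asFiber`, Mathlib `IsAffineOpen.arrowStalkMapIso`), so
`𝔮` is a minimal prime over `𝔭ᵢ R'` (`Literature.RingTheory.KrullDimension.mem_minimalPrimes_map_of_length_ne_top`;
Görtz–Wedhorn I, proof of Cor. 5.45 (2)). A Noetherian ring has finitely many minimal primes
over each ideal (Mathlib `Ideal.finite_minimalPrimes_of_isNoetherianRing`), and points of the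
affine open `U'` are determined by their primes, so `U' ∩ supp (f^* c)` is finite.

## Main results

* `Literature.AlgebraicGeometry.Motives.primeIdealOf_mem_minimalPrimes_of_isGenericComponentPoint`: in affine charts
  `U' ⊆ f⁻¹ U`, a generic point of a component of its fibre corresponds to a minimal prime over
  the extension of the prime of its image.
* `Literature.AlgebraicGeometry.Motives.locallyFiniteSupport_flatPullbackFun_of_isLocallyNoetherian`: `f^* c` has locally finite
  support for any `f : X ⟶ Y` with `X` locally Noetherian.
* `Literature.AlgebraicGeometry.Motives.locallyFinsupp_flatPullbackFun_baseChangeHomFst_holds`: discharge of the named fact.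

## References

* W. Fulton, *Intersection Theory*, 2nd ed. (1998), §1.5 (p. 15), §1.7 (p. 18, Lemma 1.7.1),
  Example 6.2.9. (The fact is vendored citing "Example 6.1.2"; the printed statement on field
  extension is Example 6.2.9, as already noted in `SubschemeCyclesBaseChangeProofs`.)
* U. Görtz, T. Wedhorn, *Algebraic Geometry I: Schemes*, 2nd ed. (2020), Cor. 5.45 (p. 166) and
  its proof ("a prime ideal `𝔯` in a ring `R` is minimal if and only if `R_𝔯` has only one prime
  ideal").
* Mathlib: `Ideal.finite_minimalPrimes_of_isNoetherianRing` (a Noetherian ring has finitely many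
  minimal primes over an ideal), `IsAffineOpen.arrowStalkMapIso`, `IsAffineOpen.primeIdealOf`.
-/

universe u

open CategoryTheory AlgebraicGeometry Limits IsLocalRing Topology

namespace Literature.AlgebraicGeometry.Motives

variable {X Y : Scheme.{u}}

/-! ### Points of an affine open and primes -/

/-- The prime `𝔭_x ⊂ Γ(X, U)` of a point `x` of an affine open `U = Spec Γ(X, U)` determines the
point (`U → Spec Γ(X, U)` is an isomorphism; Hartshorne II.2). [folklore] -/
lemma primeIdealOf_injective {U : X.Opens} (hU : IsAffineOpen U) :
    Function.Injective hU.primeIdealOf := fun a b h ↦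
  Subtype.ext (by rw [← hU.fromSpec_primeIdealOf a, ← hU.fromSpec_primeIdealOf b, h])

/-- **Generic points of fibre components are minimal primes over the extended prime.** Let
`f : X ⟶ Y`, `U ⊆ Y` and `U' ⊆ f⁻¹ U` affine opens, `x ∈ U'` with primes `𝔮 = 𝔭_x ⊂ Γ(X, U')`,
`𝔭 = 𝔭_{f x} ⊂ Γ(Y, U)`. If `x` is a generic point of an irreducible component of its fibre
`X_{f x}`, i.e. the local ring `𝒪_{X_{f x}, x} ≅ Γ(X,U')_𝔮 ⧸ 𝔭 Γ(X,U')_𝔮` has finite length, then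
`𝔮` is a minimal prime over `𝔭 Γ(X, U')` (Görtz–Wedhorn I, proof of Cor. 5.45 (2); this is the
step that makes `f⁻¹(V) ∩ U'`, `V = closure {f x}`, have the closures of such `x` as components,
Fulton, *Intersection Theory*, §1.7, Lemma 1.7.1).
[cite: GortzWedhorn2020, Cor. 5.45 (2) (proof)] -/
theorem primeIdealOf_mem_minimalPrimes_of_isGenericComponentPoint (f : X ⟶ Y) {U : Y.Opens}
    (hU : IsAffineOpen U) {U' : X.Opens} (hU' : IsAffineOpen U') (hU'U : U' ≤ f ⁻¹ᵁ U) {x : X}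
    (hx : x ∈ U') (hgen : IsGenericComponentPoint (f.fiber (f x)) (f.asFiber x)) :
    (hU'.primeIdealOf ⟨x, hx⟩).asIdeal ∈
      ((hU.primeIdealOf ⟨f x, hU'U hx⟩).asIdeal.map (f.appLE U U' hU'U).hom).minimalPrimes := by
  have hcomap : (hU.primeIdealOf ⟨f x, hU'U hx⟩).asIdeal =
      Ideal.comap (f.appLE U U' hU'U).hom (hU'.primeIdealOf ⟨x, hx⟩).asIdeal :=
    congr($(IsAffineOpen.comap_primeIdealOf_appLE U hU U' hU' hU'U hx).1).symm
  refine Literature.RingTheory.KrullDimension.mem_minimalPrimes_map_of_length_ne_top (f.appLE U U' hU'U).hom _ _ hcomap ?_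
  -- transport the length along `𝒪_{X_{f x}, x} ≅ 𝒪_{X,x} ⧸ 𝔪_{f x} 𝒪_{X,x} ≅ R'_𝔮 ⧸ 𝔪_{R_𝔭} R'_𝔮`
  obtain ⟨e₁⟩ := nonempty_stalkFiber_ringEquiv_asFiber f x
  obtain ⟨e₂⟩ := nonempty_fiberQuot_ringEquiv_of_arrowIso
    (IsAffineOpen.arrowStalkMapIso f U hU U' hU' hU'U hx)
  have E := (SubschemeCyclesProofs.length_self_eq_of_ringEquiv e₁).trans (SubschemeCyclesProofs.length_self_eq_of_ringEquiv e₂)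
  exact fun h ↦ hgen.ne (E.trans h)

/-! ### Local finiteness of the support of `f^* c` -/

/-- **The flat pull-back of a cycle is a cycle** (local finiteness of the support; Fulton,
*Intersection Theory*, §1.7 with §1.5: `f^*[V] = [f⁻¹(V)]` is the cycle of the scheme `f⁻¹(V)`,
a finite sum over its irreducible components). For any morphism `f : X ⟶ Y` with `X`
locally Noetherian and any cycle `c` on `Y`, the coefficient function
`x ↦ c(f x) · ℓ(𝒪_{X_{f x}, x})` has locally finite support: on an affine open `U' = Spec R' ∋ x`
over an affine open `U ∋ f x`, its support consists of points whose primes are minimal over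
`𝔭_y R'` for one of the finitely many `y ∈ U ∩ supp c`
(`primeIdealOf_mem_minimalPrimes_of_isGenericComponentPoint`), and the Noetherian ring `R'` has
finitely many minimal primes over each ideal. Flatness of `f` plays no role.
[cite: Fulton1998, §1.7] -/
theorem locallyFiniteSupport_flatPullbackFun_of_isLocallyNoetherian (f : X ⟶ Y)
    [IsLocallyNoetherian X] (c : AlgebraicCycle Y ℤ) :
    LocallyFiniteSupport (f.flatPullbackFun c) := by
  intro z
  -- affine charts `U ∋ f z` of `Y` and `U' ∋ z` of `X` with `U' ⊆ f⁻¹ U`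
  obtain ⟨_, ⟨U, hU, rfl⟩, hxU, -⟩ :=
    Y.isBasis_affineOpens.exists_subset_of_mem_open (Set.mem_univ (f z)) isOpen_univ
  obtain ⟨_, ⟨U', hU', rfl⟩, hzU', hU'U⟩ :=
    X.isBasis_affineOpens.exists_subset_of_mem_open (show z ∈ (f ⁻¹ᵁ U : Set X) from hxU)
      (f ⁻¹ᵁ U).isOpen
  replace hU'U : U' ≤ f ⁻¹ᵁ U := hU'U
  refine ⟨U', U'.isOpen.mem_nhds hzU', ?_⟩
  -- `supp c` meets the quasi-compact `U` in a finite set; `Γ(X, U')` is Noetherian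
  have hfin : ((U : Set Y) ∩ Function.support c).Finite :=
    c.locallyFiniteSupport.finite_inter_support_of_isCompact hU.isCompact
  haveI := hfin.to_subtype
  haveI : IsNoetherianRing Γ(X, U') := IsLocallyNoetherian.component_noetherian ⟨U', hU'⟩
  -- the candidate primes: minimal primes over `𝔭_y Γ(X, U')` for `y ∈ U ∩ supp c`
  let T : Set (PrimeSpectrum Γ(X, U')) := ⋃ y : ↥((U : Set Y) ∩ Function.support c),
    {𝔮 | 𝔮.asIdeal ∈
      ((hU.primeIdealOf ⟨y.1, y.2.1⟩).asIdeal.map (f.appLE U U' hU'U).hom).minimalPrimes}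
  have hT : T.Finite := Set.finite_iUnion fun y ↦
    (Ideal.finite_minimalPrimes_of_isNoetherianRing _ _).preimage
      fun _ _ _ _ h ↦ PrimeSpectrum.ext h
  refine ((hT.preimage fun _ _ _ _ h ↦ primeIdealOf_injective hU' h).image
    (fun z' : U' ↦ (z' : X))).subset ?_
  rintro z' ⟨hz'U', hz'⟩
  refine ⟨⟨z', hz'U'⟩, ?_, rfl⟩
  obtain ⟨hc0, hgen⟩ := isGenericComponentPoint_of_flatPullbackFun_ne_zero f c hz'
  exact Set.mem_iUnion.mpr ⟨⟨f z', hU'U hz'U', hc0⟩,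
    primeIdealOf_mem_minimalPrimes_of_isGenericComponentPoint f hU hU' hU'U hz'U' hgen⟩

/-! ### Discharge of `locallyFinsupp_flatPullbackFun_baseChangeHomFst` -/

/-- **Fulton, Intersection Theory, Example 6.2.9** ("For a `k`-cycle `α = ∑ n_V [V]` on `X`, let
`α_L` be the `k`-cycle `∑ n_V [V_L]` on `X_L`"). Discharge of the named fact
`Literature.AlgebraicGeometry.Motives.locallyFinsupp_flatPullbackFun_baseChangeHomFst`: for `X` locally of finite type over `k` and
a homomorphism of fields `σ : k →+* L`, pull-back of cycles along the projection
`π : X_σ = X ×_{k,σ} Spec L ⟶ X` has locally finite support, because `X_σ` is locally of finite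
type over `L`, hence locally Noetherian
(`locallyFiniteSupport_flatPullbackFun_of_isLocallyNoetherian`). Note on the locator: the fact is
vendored in `SubschemeCycles` citing "Fulton Ex. 6.1.2"; the printed statement is Example 6.2.9.
[cite: Fulton1998, Example 6.2.9] -/
theorem locallyFinsupp_flatPullbackFun_baseChangeHomFst_holds :
    locallyFinsupp_flatPullbackFun_baseChangeHomFst.{u} := by
  intro k L _ _ σ X _ c
  haveI := locallyOfFiniteType_baseChangeHom_obj_hom σ X
  haveI : IsLocallyNoetherian ((baseChangeHom σ).obj X).left :=
    LocallyOfFiniteType.isLocallyNoetherian ((baseChangeHom σ).obj X).hom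
  exact locallyFiniteSupport_flatPullbackFun_of_isLocallyNoetherian (baseChangeHomFst σ X) c

end Literature.AlgebraicGeometry.Motives
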